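import Literature.MathematicalPhysics.QuantumFieldTheory.Balaban1983to89.B4Prop31Holonomy
import Literature.MathematicalPhysics.QuantumFieldTheory.Balaban1983to89.B4Prop31Zero

/-!
# `Balaban1983to89.B4Prop31Charts` — T. Bałaban, *Regularity and decay of lattice Green's functions*, Commun. Math.
Phys. **89** (1983) 571–597 [Balaban1983RegularityDecay] (= [B4]): «Proposition 3.1′ of [2]» (1.21)–(1.22) p. 574 at
`A ≠ 0` — file 3a/3: CARRIERS AND BLOCK CHARTS on a union of unit blocks (the link variables and transporters of
(1.2)/(1.4) on `Ω = ⋃_{y∈Ω^{(k)}} B(y)`, the covariant bond sum of (1.22), block decomposition of sums, and the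
counting of the fine bonds of the prisms of §4)

statement-level skeleton of published theorems with citation tags; proofs where landed; nothing here is a claim about
the Yang–Mills mass gap

PDF held: `paper:balaban1983-cmp89-regularity-decay` (journal page = PDF page + 570); pp. 572–574 [PDF 2–4], 589–591
[PDF 19–21] read.

CITATION HEADER (lean-in-tree rule).  Phase-2 PROOF file of the lit-balaban typed skeleton (HOME
`run/shared/lean/pub/lit-balaban/`), SKELETON row **`B4.Prop3.1'[II]`** (owner r01, referee ref-4), seat p35 gen 2 (unit
`lit-balaban-p35`); companions `B4Prop31Energy` (file 1: the variational representation (4.1)–(4.3) of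
`Δ^{(k)}(Ω,A)`), `B4Prop31Prism` (2a: abelian prism inequality), `B4Prop31Holonomy` (2b: contour sums, holonomy bound
from (1.21)), `B4Prop31Averaging` (3b: the covariant averaging inequality), `B4Prop31Regular` (3c: (1.22) and the
typed leaf `B4.Prop31Printed` on the regular-region family).

THE PRINTED TEXT it serves (p. 574 [PDF 4], (1.22)): *"⟨φ, Δ^{(k)}(Ω,A)φ⟩ ≥ γ₀(Σ_{⟨x,x′⟩⊂Ω^{(k)}}|U(A(⟨x,x′⟩))φ(x′)
− φ(x)|² + m²Σ_{x∈Ω^{(k)}}|φ(x)|²) − O(1)e^{2−α}Σ_{x∈Ω^{(k)}}|φ(x)|²"* («Ω a sum of unit blocks (i.e. Ω^{(k)} is an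
arbitrary subset of Z^d)»), and p. 590 [PDF 20] (4.7) «Δ(x,x′) = B^k(x) ∪ B^k(x′)» with the contours of (4.8).
DICTIONARY (lattice units, as `B4Lower18RegularRegion`/`B4Prop31Holonomy`): `η = 1/n`; fine region `fineDom n Ωc`
of the unit labels `Ωc ⊂ ℤ^{d+1}`; `U(A(⟨y, y+e_μ⟩)) = B4Prop31Holonomy.clink`; the block `B(y)` is charted by
`j ↦ n·y + j`, `j ∈ {0,…,n−1}^{d+1}` (`xpt`).

WHAT IS KERNEL-CHECKED (zero `sorry`, standard axioms; no new `Prop`-valued statement): the carriers `linkR`/`transR`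
(= [B4]'s (1.2)/(1.4) on the region; `b4Op_region_eq`: the operator (1.6) of `B4Lower18RegularRegion` is their
`covOp`, definitionally), the zero extension `extR`, THE COVARIANT BOND SUM OF (1.22) `covDiffSq`, the fine bond energy
`gbond`; bookkeeping: `sum_subtype_ite_eq`, `sum_dir_ite_le`, `sum_blocks` (`Σ_{x∈Ω} = Σ_y Σ_{x∈B(y)}`),
`fld_avgOp_chart` ((1.4) in the chart), `sum_shift_le`, `block_pair_count_le`; and the two counting facts behind the
averaging inequality: `chart_shift_sum_le` (the straight faces `[x, x+e_μ]` of the prisms over `B(y)` are injectively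
charted fine bonds of `B(y) ∪ B(y+e_μ) ⊂ Ω`) and `double_count_le` (each fine bond serves at most two unit bonds per
direction).
Unit `lit-balaban-p35` (gen 2), HOME as above.
-/

namespace Literature.MathematicalPhysics.QuantumFieldTheory.Balaban1983to89.B4Prop31Charts

open Matrix Finset
open Literature.MathematicalPhysics.QuantumFieldTheory.Balaban1983to89.B4GaugeCovariance
open Literature.MathematicalPhysics.QuantumFieldTheory.Balaban1983to89.B4Lower18Regular
  (dotProduct_self_nonneg' dotProduct_eq_sum_fld transport_fieldLink e1 e1_apply_self e1_apply_ne)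
open Literature.MathematicalPhysics.QuantumFieldTheory.Balaban1983to89.B4Lower18RegularRegion
  (regWt rBlkWt rbaseEmb rstairContour compField e1_inj)
open Literature.MathematicalPhysics.QuantumFieldTheory.Balaban1983to89.B4Reflection242 (nbrs blk mem_nbrs)
open Literature.MathematicalPhysics.QuantumFieldTheory.Balaban1983to89.B4Lower18 (fineDom mem_fineDom)
open Literature.MathematicalPhysics.QuantumFieldTheory.Balaban1983to89.B4BoxCov237
  (finePt_apply blk_finePt finePt_injective)
open Literature.MathematicalPhysics.QuantumFieldTheory.Balaban1983to89.B4Prop31Zero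
  (finePt_mem_fineDom filter_blk_eq_imageR)
open Literature.MathematicalPhysics.QuantumFieldTheory.Balaban1983to89.B4Prop31Holonomy

open B4Green244 (finePt)

noncomputable section

variable {ι : Type*} [Fintype ι] [DecidableEq ι] {d : ℕ}

/-! ## §1  Carriers on the fine region: link variables, transporters, zero extension, block charts -/

/-- [B4]'s LINK VARIABLES `U(A_b) = exp(qeηA_b)` (1.2), `b ⊂ Ω`, of a vector field in component form `A_ν(x)` at
coupling `κ = eη`, on the fine region `Ω = ⋃_{y∈Ωc} B(y)`. [cite: Balaban1983RegularityDecay, p. 572 (1.2),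
dictionary] -/
def linkR (F : OrthFlow ι) (κ : ℝ) (n : ℕ) (Ωc : Finset (Fin (d + 1) → ℤ))
    (Ac : (Fin (d + 1) → ℤ) → Fin (d + 1) → ℝ) : ↥(fineDom n Ωc) → ↥(fineDom n Ωc) → Matrix ι ι ℝ :=
  fieldLink F κ fun u v : ↥(fineDom n Ωc) => compField Ac u.1 v.1

/-- [B4]'s TRANSPORTERS `U(A(Γ^{(k)}_{y,x}))` of (1.4) on `Ω` along the staircase contours from the base corners
`n·y`. [cite: Balaban1983RegularityDecay, p. 572 (1.4), dictionary] -/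
def transR (F : OrthFlow ι) (κ : ℝ) {n : ℕ} (hn : 1 ≤ n) (Ωc : Finset (Fin (d + 1) → ℤ))
    (Ac : (Fin (d + 1) → ℤ) → Fin (d + 1) → ℝ) : ↥Ωc → ↥(fineDom n Ωc) → Matrix ι ι ℝ :=
  contourTrans (linkR F κ n Ωc Ac) (rbaseEmb hn Ωc) (rstairContour hn Ωc)

/-- the transporters are orthogonal (`U(A(Γ)) = F.U(κA(Γ))`). [cite: Balaban1983RegularityDecay, p. 572 (1.2), (1.4)] -/
theorem transR_orth (F : OrthFlow ι) (κ : ℝ) {n : ℕ} (hn : 1 ≤ n) (Ωc : Finset (Fin (d + 1) → ℤ))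
    (Ac : (Fin (d + 1) → ℤ) → Fin (d + 1) → ℝ) (y : ↥Ωc) (x : ↥(fineDom n Ωc)) :
    (transR F κ hn Ωc Ac y x)ᵀ * transR F κ hn Ωc Ac y x = 1 := by
  unfold transR contourTrans linkR
  rw [transport_fieldLink]
  exact F.orth _

/-- [B4]'s operator (1.6) `−Δ^{η,N}_{A,Ω} + m² + a_kP_k(A)` on the union of unit blocks is `covOp` of these carriers
(definitional bridge to `B4Lower18RegularRegion`). [cite: Balaban1983RegularityDecay, p. 572 (1.6), dictionary] -/
theorem b4Op_region_eq (F : OrthFlow ι) (κ : ℝ) {n : ℕ} (hn : 1 ≤ n) (Ωc : Finset (Fin (d + 1) → ℤ))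
    (Ac : (Fin (d + 1) → ℤ) → Fin (d + 1) → ℝ) (m2 a' : ℝ) :
    b4Op F κ (regWt n (fineDom n Ωc)) m2 a' (rBlkWt n Ωc (fineDom n Ωc)) (rbaseEmb hn Ωc) (rstairContour hn Ωc)
        (fun u v => compField Ac u.1 v.1)
      = covOp (regWt n (fineDom n Ωc)) m2 a' (rBlkWt n Ωc (fineDom n Ωc)) (linkR F κ n Ωc Ac)
          (transR F κ hn Ωc Ac) := rfl

/-- EXTENSION BY ZERO of a field on a finite set of lattice sites to the whole lattice (bookkeeping device for the
straight faces `[x, x + e_μ]` of the prisms, which stay in `Ω` when both end blocks do).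
[cite: Balaban1983RegularityDecay, p. 590 (4.8), dictionary] -/
def extR {R : Finset (Fin (d + 1) → ℤ)} (Φ : ↥R × ι → ℝ) (z : Fin (d + 1) → ℤ) : ι → ℝ :=
  if h : z ∈ R then fld Φ ⟨z, h⟩ else 0

omit [Fintype ι] [DecidableEq ι] in
/-- the zero extension agrees with the field on the set. [cite: Balaban1983RegularityDecay, p. 590 (4.8), dictionary] -/
theorem extR_of_mem {R : Finset (Fin (d + 1) → ℤ)} (Φ : ↥R × ι → ℝ) (x : ↥R) : extR Φ x.1 = fld Φ x := by
  unfold extR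
  rw [dif_pos x.2]

/-- THE BLOCK CHART: the fine point `n·y + j` of `B(y)`, `j ∈ {0,…,n−1}^{d+1}`, as a point of the fine region.
[cite: Balaban1983RegularityDecay, p. 572 (1.1), dictionary] -/
def xpt {n : ℕ} (hn : 1 ≤ n) {Ωc : Finset (Fin (d + 1) → ℤ)} (y : ↥Ωc) (j : Fin (d + 1) → Fin n) :
    ↥(fineDom n Ωc) :=
  ⟨finePt n y.1 j, finePt_mem_fineDom hn y.2 j⟩

/-- **THE COVARIANT BOND SUM OF (1.22)** `Σ_{⟨y,y′⟩⊂Ω^{(k)}} |U(A(⟨y,y′⟩))φ(y′) − φ(y)|²` over the positively oriented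
unit-lattice bonds `y′ = y + e_μ` with both ends in `Ω^{(k)}`, `U(A(⟨y,y′⟩)) = B4Prop31Holonomy.clink`.
[cite: Balaban1983RegularityDecay, p. 574 (1.22)] -/
def covDiffSq (F : OrthFlow ι) (κ : ℝ) (Ac : (Fin (d + 1) → ℤ) → Fin (d + 1) → ℝ) (n : ℕ)
    (Ωc : Finset (Fin (d + 1) → ℤ)) (ψ : ↥Ωc × ι → ℝ) : ℝ :=
  ∑ y : ↥Ωc, ∑ μ : Fin (d + 1),
    if h : y.1 + e1 μ ∈ Ωc then
      (clink F κ Ac n y.1 μ *ᵥ fld ψ ⟨y.1 + e1 μ, h⟩ - fld ψ y) ⬝ᵥ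
        (clink F κ Ac n y.1 μ *ᵥ fld ψ ⟨y.1 + e1 μ, h⟩ - fld ψ y)
    else 0

/-- THE FINE COVARIANT BOND ENERGY `|U(A_{⟨z, z+e_μ⟩})Φ(z + e_μ) − Φ(z)|²` of the zero-extended field (a term of (1.3)
when both ends lie in `Ω`). [cite: Balaban1983RegularityDecay, p. 572 (1.3), dictionary] -/
def gbond (F : OrthFlow ι) (κ : ℝ) (Ac : (Fin (d + 1) → ℤ) → Fin (d + 1) → ℝ) {R : Finset (Fin (d + 1) → ℤ)}
    (Φ : ↥R × ι → ℝ) (μ : Fin (d + 1)) (z : Fin (d + 1) → ℤ) : ℝ :=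
  (F.U (κ * Ac z μ) *ᵥ extR Φ (z + e1 μ) - extR Φ z) ⬝ᵥ (F.U (κ * Ac z μ) *ᵥ extR Φ (z + e1 μ) - extR Φ z)

/-- `gbond ≥ 0`. [cite: Balaban1983RegularityDecay, p. 572 (1.3), dictionary] -/
theorem gbond_nonneg (F : OrthFlow ι) (κ : ℝ) (Ac : (Fin (d + 1) → ℤ) → Fin (d + 1) → ℝ)
    {R : Finset (Fin (d + 1) → ℤ)} (Φ : ↥R × ι → ℝ) (μ : Fin (d + 1)) (z : Fin (d + 1) → ℤ) :
    0 ≤ gbond F κ Ac Φ μ z :=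
  dotProduct_self_nonneg' _

/-! ## §2  Finite-sum bookkeeping: indicator sums over a region, block decomposition, charts of `Q_k(A)` -/

/-- an indicator sum over the sites of a finite region picks the value at the site (or `0` if it is outside).
[cite: Balaban1983RegularityDecay, p. 572 (1.1), dictionary (bookkeeping)] -/
theorem sum_subtype_ite_eq {S : Finset (Fin (d + 1) → ℤ)} (z : Fin (d + 1) → ℤ) (f : ↥S → ℝ) :
    ∑ v : ↥S, (if v.1 = z then f v else 0) = if h : z ∈ S then f ⟨z, h⟩ else 0 := by
  by_cases h : z ∈ S
  · rw [dif_pos h, Finset.sum_eq_single (⟨z, h⟩ : ↥S)]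
    · rw [if_pos rfl]
    · intro v _ hv
      rw [if_neg]
      intro hvz
      exact hv (Subtype.ext hvz)
    · intro hz
      exact absurd (Finset.mem_univ _) hz
  · rw [dif_neg h]
    refine Finset.sum_eq_zero fun v _ => ?_
    rw [if_neg]
    intro hvz
    exact h (hvz ▸ v.2)

/-- at most one lattice direction `μ` has `v = u + e_μ`. [cite: Balaban1983RegularityDecay, p. 572 (1.3), dictionary
(bookkeeping)] -/
theorem sum_dir_ite_le {u v : Fin (d + 1) → ℤ} {c : ℝ} (hc : 0 ≤ c) :
    (∑ μ : Fin (d + 1), if v = u + e1 μ then c else 0) ≤ c := by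
  by_cases h : ∃ μ, v = u + e1 μ
  · obtain ⟨μ₀, h0⟩ := h
    rw [Finset.sum_eq_single μ₀]
    · rw [if_pos h0]
    · intro μ _ hne
      rw [if_neg]
      intro hμ
      apply hne
      rw [h0] at hμ
      exact (e1_inj.1 (add_left_cancel hμ)).symm
    · intro h
      exact absurd (Finset.mem_univ _) h
  · have h' : ∀ μ, ¬ v = u + e1 μ := fun μ hμ => h ⟨μ, hμ⟩
    rw [Finset.sum_eq_zero (fun μ _ => if_neg (h' μ))]
    exact hc

/-- **BLOCK DECOMPOSITION** of a sum over the fine region: `Σ_{x∈Ω} f(x) = Σ_{y∈Ω^{(k)}} Σ_{x∈B(y)} f(x)`, the block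
`B(y)` charted by `j ↦ n·y + j`. [cite: Balaban1983RegularityDecay, p. 572 (1.1), dictionary] -/
theorem sum_blocks {n : ℕ} (hn : 1 ≤ n) (Ωc : Finset (Fin (d + 1) → ℤ)) (f : ↥(fineDom n Ωc) → ℝ) :
    ∑ x, f x = ∑ y : ↥Ωc, ∑ j : Fin (d + 1) → Fin n, f (xpt hn y j) := by
  set lab : ↥(fineDom n Ωc) → ↥Ωc := fun x => ⟨blk n x.1, (mem_fineDom hn).1 x.2⟩ with hlab
  rw [← Finset.sum_fiberwise Finset.univ lab f]
  refine Finset.sum_congr rfl fun y _ => ?_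
  have hfilter : Finset.univ.filter (fun x => lab x = y)
      = Finset.univ.filter (fun x : ↥(fineDom n Ωc) => blk n x.1 = y.1) :=
    Finset.filter_congr fun x _ => by rw [hlab, Subtype.ext_iff]
  rw [hfilter, filter_blk_eq_imageR hn Ωc y, Finset.sum_image]
  · rfl
  · intro j _ j' _ h
    exact finePt_injective n y.1 (congrArg Subtype.val h)

omit [DecidableEq ι] in
/-- `|Φ|² = Σ_y Σ_{x∈B(y)} |Φ(x)|²`. [cite: Balaban1983RegularityDecay, p. 572 (1.1), dictionary] -/
theorem dotProduct_self_eq_sum_blocks {n : ℕ} (hn : 1 ≤ n) (Ωc : Finset (Fin (d + 1) → ℤ))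
    (Φ : ↥(fineDom n Ωc) × ι → ℝ) :
    Φ ⬝ᵥ Φ = ∑ y : ↥Ωc, ∑ j : Fin (d + 1) → Fin n, fld Φ (xpt hn y j) ⬝ᵥ fld Φ (xpt hn y j) := by
  rw [dotProduct_eq_sum_fld, sum_blocks hn Ωc]

/-- **(1.4) IN THE BLOCK CHART**: `(QΦ)(y) = Σ_{j} U(A(Γ_{y, n·y+j}))Φ(n·y + j)` with the transporter in closed form
`U(A(Γ_{y,x})) = F.U(κ·A(Γ_{y,x}))`. [cite: Balaban1983RegularityDecay, p. 572 (1.4)] -/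
theorem fld_avgOp_chart (F : OrthFlow ι) (κ : ℝ) {n : ℕ} (hn : 1 ≤ n) (Ωc : Finset (Fin (d + 1) → ℤ))
    (Ac : (Fin (d + 1) → ℤ) → Fin (d + 1) → ℝ) (Φ : ↥(fineDom n Ωc) × ι → ℝ) (y : ↥Ωc) :
    fld (avgOp (rBlkWt n Ωc (fineDom n Ωc)) (transR F κ hn Ωc Ac) *ᵥ Φ) y
      = ∑ j : Fin (d + 1) → Fin n, F.U (κ * stairSum Ac n y.1 (finePt n y.1 j)) *ᵥ fld Φ (xpt hn y j) := by
  rw [fld_avgOp_mulVec]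
  have h1 : ∀ x : ↥(fineDom n Ωc), rBlkWt n Ωc (fineDom n Ωc) y x • (transR F κ hn Ωc Ac y x *ᵥ fld Φ x)
      = if blk n x.1 = y.1 then transR F κ hn Ωc Ac y x *ᵥ fld Φ x else 0 := by
    intro x
    unfold rBlkWt
    split_ifs
    · rw [one_smul]
    · rw [zero_smul]
  simp_rw [h1]
  rw [← Finset.sum_filter, filter_blk_eq_imageR hn Ωc y, Finset.sum_image]
  · refine Finset.sum_congr rfl fun j _ => ?_
    have hT : transR F κ hn Ωc Ac y (xpt hn y j) = F.U (κ * stairSum Ac n y.1 (finePt n y.1 j)) :=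
      contourTrans_region_eq F κ hn Ωc Ac y (xpt hn y j) (blk_finePt hn y.1 j)
    exact congrArg (fun M : Matrix ι ι ℝ => M *ᵥ fld Φ (xpt hn y j)) hT
  · intro j _ j' _ h
    exact finePt_injective n y.1 (congrArg Subtype.val h)

/-! ## §3  Counting on the unit lattice -/

/-- **SHIFTED SUMS**: `Σ_{y : y+e_μ ∈ Ω^{(k)}} G(y + e_μ) ≤ Σ_y G(y)` for `G ≥ 0`.
[cite: Balaban1983RegularityDecay, p. 574 (1.22), bookkeeping] -/
theorem sum_shift_le {Ωc : Finset (Fin (d + 1) → ℤ)} {G : ↥Ωc → ℝ} (hG : ∀ y, 0 ≤ G y) (μ : Fin (d + 1)) :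
    ∑ y : ↥Ωc, (if h : y.1 + e1 μ ∈ Ωc then G ⟨y.1 + e1 μ, h⟩ else 0) ≤ ∑ y : ↥Ωc, G y := by
  have h1 : ∀ y : ↥Ωc, (if h : y.1 + e1 μ ∈ Ωc then G ⟨y.1 + e1 μ, h⟩ else 0)
      = ∑ v : ↥Ωc, if v.1 = y.1 + e1 μ then G v else 0 := fun y => (sum_subtype_ite_eq _ G).symm
  rw [Fintype.sum_congr _ _ h1, Finset.sum_comm]
  refine Finset.sum_le_sum fun v _ => ?_
  have h2 : ∀ y : ↥Ωc, (if v.1 = y.1 + e1 μ then G v else 0) = if y.1 = v.1 - e1 μ then G v else 0 := by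
    intro y
    by_cases hv : v.1 = y.1 + e1 μ
    · rw [if_pos hv, if_pos (by rw [hv, add_sub_cancel_right])]
    · rw [if_neg hv, if_neg (fun h => hv (by rw [h, sub_add_cancel]))]
  rw [Fintype.sum_congr _ _ h2, sum_subtype_ite_eq (v.1 - e1 μ) (fun _ => G v)]
  split_ifs
  · exact le_rfl
  · exact hG v

/-- at most TWO unit labels `y` have `b ∈ {y, y + e_μ}`. [cite: Balaban1983RegularityDecay, p. 590 (4.7)
«Δ(x,x′) = B^k(x) ∪ B^k(x′)», bookkeeping] -/
theorem block_pair_count_le {Ωc : Finset (Fin (d + 1) → ℤ)} (b : Fin (d + 1) → ℤ) (μ : Fin (d + 1)) :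
    (∑ y : ↥Ωc, if b = y.1 ∨ b = y.1 + e1 μ then (1 : ℝ) else 0) ≤ 2 := by
  have h1 : ∀ y : ↥Ωc, (if b = y.1 ∨ b = y.1 + e1 μ then (1 : ℝ) else 0)
      ≤ (if y.1 = b then 1 else 0) + (if y.1 = b - e1 μ then 1 else 0) := by
    intro y
    by_cases hP : y.1 = b
    · rw [if_pos hP]
      split_ifs <;> norm_num
    · rw [if_neg hP]
      by_cases hQ : y.1 = b - e1 μ
      · rw [if_pos hQ, if_pos (Or.inr (by rw [hQ, sub_add_cancel]))]
        norm_num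
      · rw [if_neg hQ, if_neg]
        · norm_num
        · rintro (h | h)
          · exact hP h.symm
          · exact hQ (by rw [h, add_sub_cancel_right])
  refine (Finset.sum_le_sum fun y _ => h1 y).trans ?_
  rw [Finset.sum_add_distrib, sum_subtype_ite_eq b (fun _ => (1 : ℝ)),
    sum_subtype_ite_eq (b - e1 μ) (fun _ => (1 : ℝ))]
  split_ifs <;> norm_num

/-! ## §4  The fine bonds of the prisms: they lie in `Ω`, each serves at most two unit bonds per direction, and the
positively oriented bonds are among those of (1.3) -/

/-- **THE STRAIGHT FACES ARE INJECTIVELY CHARTED**: for `i < n` the points `n·y + j + i·e_μ`, `j ∈ {0,…,n−1}^{d+1}`,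
are distinct fine points of `B(y) ∪ B(y + e_μ) ⊂ Ω` whose `μ`-successors are in `Ω`; hence a block sum of a
non-negative bond quantity along the faces is at most its sum over those bonds.
[cite: Balaban1983RegularityDecay, p. 590 (4.8)–(4.10), bookkeeping] -/
theorem chart_shift_sum_le {n : ℕ} (hn : 1 ≤ n) {Ωc : Finset (Fin (d + 1) → ℤ)} {y : Fin (d + 1) → ℤ}
    (hy : y ∈ Ωc) {μ : Fin (d + 1)} (hy' : y + e1 μ ∈ Ωc) {g : (Fin (d + 1) → ℤ) → ℝ} (hg : ∀ z, 0 ≤ g z)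
    {i : ℕ} (hi : i < n) :
    ∑ j : Fin (d + 1) → Fin n, g (finePt n y j + i • e1 μ)
      ≤ ∑ u : ↥(fineDom n Ωc),
          if u.1 + e1 μ ∈ fineDom n Ωc ∧ (blk n u.1 = y ∨ blk n u.1 = y + e1 μ) then g u.1 else 0 := by
  set J : (Fin (d + 1) → Fin n) → ↥(fineDom n Ωc) := fun j =>
    ⟨finePt n y j + i • e1 μ, add_nsmul_e1_mem_fineDom hn (blk_finePt hn y j) hy hy' hi.le⟩ with hJ
  have hJinj : Function.Injective J := by
    intro j j' h
    have h' : finePt n y j + i • e1 μ = finePt n y j' + i • e1 μ := congrArg Subtype.val h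
    exact finePt_injective n y (add_right_cancel h')
  have h1 : ∑ j, g (finePt n y j + i • e1 μ) = ∑ u ∈ Finset.univ.image J, g u.1 := by
    rw [Finset.sum_image (fun j _ j' _ h => hJinj h)]
  rw [h1, ← Finset.sum_filter]
  refine Finset.sum_le_sum_of_subset_of_nonneg ?_ (fun u _ _ => hg u.1)
  intro u hu
  rw [Finset.mem_image] at hu
  obtain ⟨j, _, rfl⟩ := hu
  rw [Finset.mem_filter]
  refine ⟨Finset.mem_univ _, ?_, ?_⟩
  · have : finePt n y j + i • e1 μ + e1 μ = finePt n y j + (i + 1) • e1 μ := by rw [succ_nsmul, add_assoc]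
    show finePt n y j + i • e1 μ + e1 μ ∈ fineDom n Ωc
    rw [this]
    exact add_nsmul_e1_mem_fineDom hn (blk_finePt hn y j) hy hy' (by omega)
  · exact blk_add_nsmul_e1 hn (blk_finePt hn y j) μ hi.le

/-- **DOUBLE COUNTING**: summing, over the unit bonds `⟨y, y+e_μ⟩ ⊂ Ω^{(k)}`, a non-negative bond quantity over the
fine `μ`-bonds of `B(y) ∪ B(y+e_μ)` counts every fine `μ`-bond of `Ω` at most twice.
[cite: Balaban1983RegularityDecay, p. 590 (4.7)–(4.10), bookkeeping] -/
theorem double_count_le (n : ℕ) (Ωc : Finset (Fin (d + 1) → ℤ))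
    {g : Fin (d + 1) → (Fin (d + 1) → ℤ) → ℝ} (hg : ∀ μ z, 0 ≤ g μ z) :
    ∑ y : ↥Ωc, ∑ μ : Fin (d + 1), (if y.1 + e1 μ ∈ Ωc then
        ∑ u : ↥(fineDom n Ωc),
          (if u.1 + e1 μ ∈ fineDom n Ωc ∧ (blk n u.1 = y.1 ∨ blk n u.1 = y.1 + e1 μ) then g μ u.1 else 0)
        else 0)
      ≤ 2 * ∑ μ : Fin (d + 1), ∑ u : ↥(fineDom n Ωc), if u.1 + e1 μ ∈ fineDom n Ωc then g μ u.1 else 0 := by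
  -- the summand without the outer indicator, factorised
  set a : Fin (d + 1) → ↥(fineDom n Ωc) → ℝ := fun μ u =>
    if u.1 + e1 μ ∈ fineDom n Ωc then g μ u.1 else 0 with ha
  set b : ↥Ωc → Fin (d + 1) → ↥(fineDom n Ωc) → ℝ := fun y μ u =>
    if blk n u.1 = y.1 ∨ blk n u.1 = y.1 + e1 μ then (1 : ℝ) else 0 with hb
  have ha0 : ∀ μ u, 0 ≤ a μ u := fun μ u => by
    simp only [ha]
    split_ifs
    · exact hg μ u.1
    · exact le_rfl
  have hb0 : ∀ y μ u, 0 ≤ b y μ u := fun y μ u => by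
    simp only [hb]
    split_ifs
    · exact zero_le_one
    · exact le_rfl
  have hab : ∀ (y : ↥Ωc) μ (u : ↥(fineDom n Ωc)),
      (if u.1 + e1 μ ∈ fineDom n Ωc ∧ (blk n u.1 = y.1 ∨ blk n u.1 = y.1 + e1 μ) then g μ u.1 else 0)
        = a μ u * b y μ u := by
    intro y μ u
    simp only [ha, hb]
    by_cases h1 : u.1 + e1 μ ∈ fineDom n Ωc
    · by_cases h2 : blk n u.1 = y.1 ∨ blk n u.1 = y.1 + e1 μ
      · rw [if_pos ⟨h1, h2⟩, if_pos h1, if_pos h2, mul_one]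
      · rw [if_neg (fun h => h2 h.2), if_neg h2, mul_zero]
    · rw [if_neg (fun h => h1 h.1), if_neg h1, zero_mul]
  have hstep1 : ∀ (y : ↥Ωc) μ, (if y.1 + e1 μ ∈ Ωc then
      ∑ u : ↥(fineDom n Ωc), (if u.1 + e1 μ ∈ fineDom n Ωc ∧ (blk n u.1 = y.1 ∨ blk n u.1 = y.1 + e1 μ)
        then g μ u.1 else 0) else 0)
        ≤ ∑ u : ↥(fineDom n Ωc), a μ u * b y μ u := by
    intro y μ
    have hS : 0 ≤ ∑ u : ↥(fineDom n Ωc), a μ u * b y μ u :=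
      Finset.sum_nonneg fun u _ => mul_nonneg (ha0 μ u) (hb0 y μ u)
    split_ifs
    · rw [Fintype.sum_congr _ _ (hab y μ)]
    · exact hS
  refine (Finset.sum_le_sum fun y _ => Finset.sum_le_sum fun μ _ => hstep1 y μ).trans ?_
  rw [Finset.sum_comm, Finset.mul_sum]
  refine Finset.sum_le_sum fun μ _ => ?_
  rw [Finset.sum_comm, Finset.mul_sum]
  refine Finset.sum_le_sum fun u _ => ?_
  rw [← Finset.mul_sum]
  have hcnt : ∑ y : ↥Ωc, b y μ u ≤ 2 := by
    simp only [hb]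
    exact block_pair_count_le (Ωc := Ωc) (blk n u.1) μ
  have h2 : a μ u * ∑ y : ↥Ωc, b y μ u ≤ a μ u * 2 := mul_le_mul_of_nonneg_left hcnt (ha0 μ u)
  show a μ u * ∑ y : ↥Ωc, b y μ u ≤ 2 * a μ u
  linarith

end

end Literature.MathematicalPhysics.QuantumFieldTheory.Balaban1983to89.B4Prop31Charts
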